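import Summits.ValiantsHypothesis.ValiantsHypothesis.Theorems.DefinabilityGapPhaseAExists
import Summits.ValiantsHypothesis.ValiantsHypothesis.Theorems.DefinabilityGapMovers
import Summits.ValiantsHypothesis.ValiantsHypothesis.Theorems.DefinabilityGapBlockedRows
import Summits.ValiantsHypothesis.ValiantsHypothesis.Theorems.DefinabilityGapAlterationStep
import HarnessLib

/-!
# Definability gap, ROAD P: the RE-PICK round exists (N1 v2 §(5c), PLAN (d) v3, parametric)

The probabilistic half of one alteration round.  The movers `Mv = movers T s₀ r key` draw new
rows independently and uniformly from re-pick sets `A₂ c` (the non-movers draw dummies); since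
every statistic a round must control is a KILL / LOAD SUM OF THE SUB-FAMILY `T' = T ∩ Mv`
(`DefinabilityGapMergeCost`, `DefinabilityGapRounds`), and a curve of `T'` meets any block in
at most two cells (incidence `≤ 2 #T' ≤ 2K`), the Phase-A machinery bounds all six event
families: mover–mover collisions (Markov, `weight_manyCollisions_le`), landings = new blocked
rows (Bernstein, `weight_exists_manyBlocked_le`), and restricted / unrestricted row and column
kill sums on every line of every block of `T` (Bernstein, `weight_rowLoadOn_le` /
`weight_colLoadOn_le`).  Main: **`exists_repick`**, with the numeric smallness as a hypothesis.
-/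

namespace Summit.ValiantsHypothesis.ValiantsHypothesis.Theorems.DefinabilityGapRepick

open Real Finset Literature.Probability.Moments
open Literature.Computability.AlgebraicComplexity Literature.Computability.MetaComplexity
open Summit.ValiantsHypothesis.ValiantsHypothesis.Theorems.DefinabilityGapAffineRung
open Summit.ValiantsHypothesis.ValiantsHypothesis.Theorems.DefinabilityGapPivotCertificate
open Summit.ValiantsHypothesis.ValiantsHypothesis.Theorems.DefinabilityGapPivotAdmissible
open Summit.ValiantsHypothesis.ValiantsHypothesis.Theorems.DefinabilityGapPivotRandom
open Summit.ValiantsHypothesis.ValiantsHypothesis.Theorems.DefinabilityGapPivotGoodLines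
open Summit.ValiantsHypothesis.ValiantsHypothesis.Theorems.DefinabilityGapPivotPhaseA
open Summit.ValiantsHypothesis.ValiantsHypothesis.Theorems.DefinabilityGapCrowdedFree
open Summit.ValiantsHypothesis.ValiantsHypothesis.Theorems.DefinabilityGapPivotColumn
open Summit.ValiantsHypothesis.ValiantsHypothesis.Theorems.DefinabilityGapPhaseAExists
open Summit.ValiantsHypothesis.ValiantsHypothesis.Theorems.DefinabilityGapMovers
open Summit.ValiantsHypothesis.ValiantsHypothesis.Theorems.DefinabilityGapBlockedRows
open Summit.ValiantsHypothesis.ValiantsHypothesis.Theorems.DefinabilityGapAlterationStep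

variable {m : ℕ}

/-! ## 1. Incidence bounds for a kill family -/

/-- A line of a block carries at most the total incidence of the family: row version.
[this file] -/
theorem sum_row_card_coCurves_le (T' : Finset (Fin 3 → Fin (qOf m)))
    (c : Fin 3 → Fin (qOf m)) (i : Fin m) (S : Finset (Fin m)) :
    ∑ j ∈ S, ((coCurves T' c (i, j)).card : ℝ) ≤ 2 * ((T'.erase c).card : ℝ) := by
  have h1 : ∑ j ∈ S, ((coCurves T' c (i, j)).card : ℝ) ≤
      ∑ j, ((coCurves T' c (i, j)).card : ℝ) :=
    Finset.sum_le_univ_sum_of_nonneg fun _ => Nat.cast_nonneg _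
  have h2 : ∑ j, ((coCurves T' c (i, j)).card : ℝ) ≤
      ∑ p : Fin m × Fin m, ((coCurves T' c p).card : ℝ) := by
    rw [Fintype.sum_prod_type]
    exact Finset.single_le_sum (f := fun a => ∑ j, ((coCurves T' c (a, j)).card : ℝ))
      (fun _ _ => Finset.sum_nonneg fun _ _ => Nat.cast_nonneg _) (Finset.mem_univ i)
  have h3 : ∑ p : Fin m × Fin m, ((coCurves T' c p).card : ℝ) ≤ 2 * ((T'.erase c).card : ℝ) := by
    exact_mod_cast sum_card_coCurves_le T' c
  linarith

/-- Column version. [this file] -/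
theorem sum_col_card_coCurves_le (T' : Finset (Fin 3 → Fin (qOf m)))
    (c : Fin 3 → Fin (qOf m)) (j : Fin m) (R : Finset (Fin m)) :
    ∑ a ∈ R, ((coCurves T' c (a, j)).card : ℝ) ≤ 2 * ((T'.erase c).card : ℝ) := by
  have h1 : ∑ a ∈ R, ((coCurves T' c (a, j)).card : ℝ) ≤
      ∑ a, ((coCurves T' c (a, j)).card : ℝ) :=
    Finset.sum_le_univ_sum_of_nonneg fun _ => Nat.cast_nonneg _
  have h2 : ∑ a, ((coCurves T' c (a, j)).card : ℝ) ≤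
      ∑ p : Fin m × Fin m, ((coCurves T' c p).card : ℝ) := by
    rw [Fintype.sum_prod_type_right]
    exact Finset.single_le_sum (f := fun b => ∑ a, ((coCurves T' c (a, b)).card : ℝ))
      (fun _ _ => Finset.sum_nonneg fun _ _ => Nat.cast_nonneg _) (Finset.mem_univ j)
  have h3 : ∑ p : Fin m × Fin m, ((coCurves T' c p).card : ℝ) ≤ 2 * ((T'.erase c).card : ℝ) := by
    exact_mod_cast sum_card_coCurves_le T' c
  linarith

/-- `colLoad T' c s ≤ 2 #(T' \ c)`. [this file] -/
theorem colLoad_le (T' : Finset (Fin 3 → Fin (qOf m))) (c : Fin 3 → Fin (qOf m)) (s : Fin m) :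
    (colLoad T' c s : ℝ) ≤ 2 * ((T'.erase c).card : ℝ) := by
  have h := sum_col_card_coCurves_le T' c s Finset.univ
  unfold colLoad
  push_cast
  exact h

/-! ## 2. Union bounds over the lines of `T` for an arbitrary kill family `T'` -/

open scoped Classical in
/-- Rows, restricted to `S c i`, kill family `T'`, incidence `≤ I`. [this file] -/
theorem weight_exists_rowKillOn_le (S : (Fin 3 → Fin (qOf m)) → Fin m → Finset (Fin m))
    {w : (Fin 3 → Fin (qOf m)) → Fin m → ℝ} (hw : ∀ c a, 0 ≤ w c a) (hw1 : ∀ c, ∑ a, w c a = 1)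
    {p I t : ℝ} (hp : 0 < p) (hwp : ∀ c', w c' ≤ fun _ => p) (T T' : Finset (Fin 3 → Fin (qOf m)))
    (hI : ∀ c i, ∑ j ∈ S c i, ((coCurves T' c (i, j)).card : ℝ) ≤ I) (hpI : 0 < p * I)
    (ht : 0 < t) :
    ∑ r ∈ (Finset.univ : Finset ((Fin 3 → Fin (qOf m)) → Fin m)).filter
        (fun r => ∃ c ∈ T, ∃ i : Fin m, p * I + t ≤
          ∑ c', rowKillOn (S c i) T' c i c' (r c')), prodWeight w r
      ≤ (T.card : ℝ) * m * exp (-(t ^ 2 / (2 * (2 * (p * I) + 2 * t / 3)))) := by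
  set B : (Fin 3 → Fin (qOf m)) × Fin m → Finset ((Fin 3 → Fin (qOf m)) → Fin m) :=
    fun ci => Finset.univ.filter fun r => p * I + t ≤
      ∑ c', rowKillOn (S ci.1 ci.2) T' ci.1 ci.2 c' (r c') with hB
  have hsub : (Finset.univ : Finset ((Fin 3 → Fin (qOf m)) → Fin m)).filter
      (fun r => ∃ c ∈ T, ∃ i : Fin m, p * I + t ≤
        ∑ c', rowKillOn (S c i) T' c i c' (r c')) ⊆
      (T ×ˢ (Finset.univ : Finset (Fin m))).biUnion B := by
    intro r hr
    obtain ⟨c, hc, i, hi⟩ := (Finset.mem_filter.mp hr).2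
    exact Finset.mem_biUnion.mpr ⟨(c, i), Finset.mem_product.mpr ⟨hc, Finset.mem_univ _⟩,
      Finset.mem_filter.mpr ⟨Finset.mem_univ _, hi⟩⟩
  have h3 : ∀ ci ∈ T ×ˢ (Finset.univ : Finset (Fin m)), ∑ r ∈ B ci, prodWeight w r ≤
      exp (-(t ^ 2 / (2 * (2 * (p * I) + 2 * t / 3)))) := fun ci _ =>
    weight_rowLoadOn_le (S ci.1 ci.2) hw hw1 hp.le hwp T' ci.1 ci.2 (hI ci.1 ci.2) hpI ht
  calc _ ≤ ∑ r ∈ (T ×ˢ (Finset.univ : Finset (Fin m))).biUnion B, prodWeight w r :=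
        Finset.sum_le_sum_of_subset_of_nonneg hsub fun r _ _ => prodWeight_nonneg hw r
    _ ≤ ∑ ci ∈ T ×ˢ (Finset.univ : Finset (Fin m)), ∑ r ∈ B ci, prodWeight w r :=
        weight_biUnion_le _ B hw
    _ ≤ ∑ ci ∈ T ×ˢ (Finset.univ : Finset (Fin m)),
          exp (-(t ^ 2 / (2 * (2 * (p * I) + 2 * t / 3)))) := Finset.sum_le_sum h3
    _ = (T.card : ℝ) * m * exp (-(t ^ 2 / (2 * (2 * (p * I) + 2 * t / 3)))) := by
        rw [Finset.sum_const, Finset.card_product, Finset.card_univ, Fintype.card_fin,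
          nsmul_eq_mul]
        push_cast
        ring

open scoped Classical in
/-- Columns, restricted to `R c j`, kill family `T'`, incidence `≤ I`. [this file] -/
theorem weight_exists_colKillOn_le (R : (Fin 3 → Fin (qOf m)) → Fin m → Finset (Fin m))
    {w : (Fin 3 → Fin (qOf m)) → Fin m → ℝ} (hw : ∀ c a, 0 ≤ w c a) (hw1 : ∀ c, ∑ a, w c a = 1)
    {p I t : ℝ} (hp : 0 < p) (hwp : ∀ c', w c' ≤ fun _ => p) (T T' : Finset (Fin 3 → Fin (qOf m)))
    (hI : ∀ c j, ∑ a ∈ R c j, ((coCurves T' c (a, j)).card : ℝ) ≤ I) (hpI : 0 < p * I)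
    (ht : 0 < t) :
    ∑ r ∈ (Finset.univ : Finset ((Fin 3 → Fin (qOf m)) → Fin m)).filter
        (fun r => ∃ c ∈ T, ∃ j : Fin m, p * I + t ≤
          ∑ c', colKillOn (R c j) T' c j c' (r c')), prodWeight w r
      ≤ (T.card : ℝ) * m * exp (-(t ^ 2 / (2 * (p * I + 1 * t / 3)))) := by
  set B : (Fin 3 → Fin (qOf m)) × Fin m → Finset ((Fin 3 → Fin (qOf m)) → Fin m) :=
    fun cj => Finset.univ.filter fun r => p * I + t ≤
      ∑ c', colKillOn (R cj.1 cj.2) T' cj.1 cj.2 c' (r c') with hB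
  have hsub : (Finset.univ : Finset ((Fin 3 → Fin (qOf m)) → Fin m)).filter
      (fun r => ∃ c ∈ T, ∃ j : Fin m, p * I + t ≤
        ∑ c', colKillOn (R c j) T' c j c' (r c')) ⊆
      (T ×ˢ (Finset.univ : Finset (Fin m))).biUnion B := by
    intro r hr
    obtain ⟨c, hc, j, hj⟩ := (Finset.mem_filter.mp hr).2
    exact Finset.mem_biUnion.mpr ⟨(c, j), Finset.mem_product.mpr ⟨hc, Finset.mem_univ _⟩,
      Finset.mem_filter.mpr ⟨Finset.mem_univ _, hj⟩⟩
  have h3 : ∀ cj ∈ T ×ˢ (Finset.univ : Finset (Fin m)), ∑ r ∈ B cj, prodWeight w r ≤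
      exp (-(t ^ 2 / (2 * (p * I + 1 * t / 3)))) := fun cj _ =>
    weight_colLoadOn_le (R cj.1 cj.2) hw hw1 hp.le hwp T' cj.1 cj.2 (hI cj.1 cj.2) hpI ht
  calc _ ≤ ∑ r ∈ (T ×ˢ (Finset.univ : Finset (Fin m))).biUnion B, prodWeight w r :=
        Finset.sum_le_sum_of_subset_of_nonneg hsub fun r _ _ => prodWeight_nonneg hw r
    _ ≤ ∑ cj ∈ T ×ˢ (Finset.univ : Finset (Fin m)), ∑ r ∈ B cj, prodWeight w r :=
        weight_biUnion_le _ B hw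
    _ ≤ ∑ cj ∈ T ×ˢ (Finset.univ : Finset (Fin m)),
          exp (-(t ^ 2 / (2 * (p * I + 1 * t / 3)))) := Finset.sum_le_sum h3
    _ = (T.card : ℝ) * m * exp (-(t ^ 2 / (2 * (p * I + 1 * t / 3)))) := by
        rw [Finset.sum_const, Finset.card_product, Finset.card_univ, Fintype.card_fin,
          nsmul_eq_mul]
        push_cast
        ring

/-! ## 3. The re-pick round -/

/-- The row Bernstein factor for kill sums (`rowKillOn ≤ 2`). [this file] -/
noncomputable def eRow (p I t : ℝ) : ℝ := exp (-(t ^ 2 / (2 * (2 * (p * I) + 2 * t / 3))))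

/-- The column Bernstein factor (`colKillOn ≤ 1`, blocked rows). [this file] -/
noncomputable def eCol (p I t : ℝ) : ℝ := exp (-(t ^ 2 / (2 * (p * I + 1 * t / 3))))

open scoped Classical in
/-- **THE RE-PICK ROUND EXISTS.**  Movers `Mv = movers T s₀ r key` (`#Mv ≤ K`) re-draw rows
from re-pick sets `A₂ c` of weight `≤ p` each (non-movers draw dummies, `1/m ≤ p`).  If the six
bounds — Markov for mover–mover collisions, Bernstein for landings, and Bernstein for the
restricted (`S`, `R`; deviation `t₂`) and unrestricted (deviation `δ`) kill sums on the lines of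
`T`, all for the kill family `T ∩ Mv` with incidence `I = 2K + 1` — sum to `< 1`, some re-pick
realises all six good events. [this file] -/
theorem exists_repick (T : Finset (Fin 3 → Fin (qOf m))) (s₀ : Fin m)
    (r : (Fin 3 → Fin (qOf m)) → Fin m) (key : (Fin 3 → Fin (qOf m)) → ℕ) (hm : 0 < m)
    (A₂ : (Fin 3 → Fin (qOf m)) → Finset (Fin m))
    (hA₂ : ∀ c ∈ movers T s₀ r key, (A₂ c).Nonempty)
    {p : ℝ} (hp0 : 0 < p) (hpm : 1 / (m : ℝ) ≤ p)
    (hAp : ∀ c ∈ movers T s₀ r key, 1 / ((A₂ c).card : ℝ) ≤ p)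
    {K : ℕ} (hK : (movers T s₀ r key).card ≤ K)
    (S R : (Fin 3 → Fin (qOf m)) → Fin m → Finset (Fin m))
    {K' lam t₂ δ : ℝ} (hK' : 0 < K') (hlam : 0 < lam) (ht₂ : 0 < t₂) (hδ : 0 < δ)
    (hsmall : p ^ 2 * (2 * (K : ℝ) * K) / K' + K * eCol p (2 * K + 1) lam +
      (T.card : ℝ) * m * (eRow p (2 * K + 1) t₂ + eCol p (2 * K + 1) t₂ +
        eRow p (2 * K + 1) δ + eCol p (2 * K + 1) δ) < 1) :
    ∃ r' : (Fin 3 → Fin (qOf m)) → Fin m,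
      (∀ c ∈ movers T s₀ r key, r' c ∈ A₂ c) ∧
      ((collCount (T ∩ movers T s₀ r key) s₀ r' : ℕ) : ℝ) < K' ∧
      (∀ c ∈ T ∩ movers T s₀ r key,
        ((blockedRows (T ∩ movers T s₀ r key) c r' s₀).card : ℝ) < p * (2 * K + 1) + lam) ∧
      (∀ c ∈ T, ∀ i : Fin m,
        ∑ c', rowKillOn (S c i) (T ∩ movers T s₀ r key) c i c' (r' c') <
          p * (2 * K + 1) + t₂) ∧
      (∀ c ∈ T, ∀ j : Fin m,
        ∑ c', colKillOn (R c j) (T ∩ movers T s₀ r key) c j c' (r' c') <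
          p * (2 * K + 1) + t₂) ∧
      (∀ c ∈ T, ∀ i : Fin m,
        ∑ c', rowKillOn Finset.univ (T ∩ movers T s₀ r key) c i c' (r' c') <
          p * (2 * K + 1) + δ) ∧
      (∀ c ∈ T, ∀ j : Fin m,
        ∑ c', colKillOn Finset.univ (T ∩ movers T s₀ r key) c j c' (r' c') <
          p * (2 * K + 1) + δ) := by
  set Mv := movers T s₀ r key with hMv
  set T' := T ∩ Mv with hT'
  have hT'K : (T'.card : ℝ) ≤ K := by
    exact_mod_cast (Finset.card_le_card Finset.inter_subset_right).trans hK
  have hK0 : (0 : ℝ) ≤ K := Nat.cast_nonneg K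
  -- incidence of the kill family
  have hinc : ∀ c, 2 * ((T'.erase c).card : ℝ) ≤ 2 * K + 1 := fun c => by
    have : ((T'.erase c).card : ℝ) ≤ T'.card := by exact_mod_cast Finset.card_erase_le
    linarith
  -- the law
  set A : (Fin 3 → Fin (qOf m)) → Finset (Fin m) := fun c => if c ∈ Mv then A₂ c else univ
    with hAdef
  have hA : ∀ c, (A c).Nonempty := fun c => by
    by_cases h : c ∈ Mv
    · rw [hAdef]; simp only [if_pos h]; exact hA₂ c h
    · rw [hAdef]; simp only [if_neg h]; exact ⟨⟨0, hm⟩, Finset.mem_univ _⟩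
  have hAp' : ∀ c, 1 / ((A c).card : ℝ) ≤ p := fun c => by
    by_cases h : c ∈ Mv
    · rw [hAdef]; simp only [if_pos h]; exact hAp c h
    · rw [hAdef]; simp only [if_neg h, Finset.card_univ, Fintype.card_fin]; exact hpm
  have hw : ∀ c a, 0 ≤ admWeight A c a := admWeight_nonneg A
  have hw1 : ∀ c, ∑ a, admWeight A c a = 1 := sum_admWeight A hA
  have hwp : ∀ c a, admWeight A c a ≤ p := fun c a => (admWeight_le A c a).trans (hAp' c)
  have hwp' : ∀ c, admWeight A c ≤ fun _ => p := fun c a => hwp c a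
  have hpI : 0 < p * (2 * K + 1) := by positivity
  -- the six events
  set E₁ := (Finset.univ : Finset ((Fin 3 → Fin (qOf m)) → Fin m)).filter
    (fun r' => K' ≤ ((collCount T' s₀ r' : ℕ) : ℝ)) with hE₁
  set E₂ := (Finset.univ : Finset ((Fin 3 → Fin (qOf m)) → Fin m)).filter
    (fun r' => ∃ c ∈ T', (colLoad T' c s₀ : ℝ) ≤ 2 * K + 1 ∧
      p * (2 * K + 1) + lam ≤ ((blockedRows T' c r' s₀).card : ℝ)) with hE₂
  set E₃ := (Finset.univ : Finset ((Fin 3 → Fin (qOf m)) → Fin m)).filter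
    (fun r' => ∃ c ∈ T, ∃ i : Fin m, p * (2 * K + 1) + t₂ ≤
      ∑ c', rowKillOn (S c i) T' c i c' (r' c')) with hE₃
  set E₄ := (Finset.univ : Finset ((Fin 3 → Fin (qOf m)) → Fin m)).filter
    (fun r' => ∃ c ∈ T, ∃ j : Fin m, p * (2 * K + 1) + t₂ ≤
      ∑ c', colKillOn (R c j) T' c j c' (r' c')) with hE₄
  set E₅ := (Finset.univ : Finset ((Fin 3 → Fin (qOf m)) → Fin m)).filter
    (fun r' => ∃ c ∈ T, ∃ i : Fin m, p * (2 * K + 1) + δ ≤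
      ∑ c', rowKillOn ((fun _ _ => Finset.univ) c i) T' c i c' (r' c')) with hE₅
  set E₆ := (Finset.univ : Finset ((Fin 3 → Fin (qOf m)) → Fin m)).filter
    (fun r' => ∃ c ∈ T, ∃ j : Fin m, p * (2 * K + 1) + δ ≤
      ∑ c', colKillOn ((fun _ _ => Finset.univ) c j) T' c j c' (r' c')) with hE₆
  have hW₁ : ∑ r' ∈ E₁, prodWeight (admWeight A) r' ≤ p ^ 2 * (2 * (K : ℝ) * K) / K' := by
    have h := weight_manyCollisions_le hw hw1 hwp T' s₀ hK'
    have hload : ∑ c ∈ T', (colLoad T' c s₀ : ℝ) ≤ 2 * K * K := by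
      calc _ ≤ ∑ c ∈ T', (2 * (K : ℝ)) := Finset.sum_le_sum fun c _ =>
              (colLoad_le T' c s₀).trans (by
                have : ((T'.erase c).card : ℝ) ≤ T'.card := by
                  exact_mod_cast Finset.card_erase_le
                linarith)
        _ = T'.card * (2 * K) := by rw [Finset.sum_const, nsmul_eq_mul]
        _ ≤ 2 * K * K := by nlinarith
    calc _ ≤ p ^ 2 * (∑ c ∈ T', (colLoad T' c s₀ : ℝ)) / K' := h
      _ ≤ p ^ 2 * (2 * (K : ℝ) * K) / K' := by
          apply div_le_div_of_nonneg_right _ hK'.le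
          exact mul_le_mul_of_nonneg_left hload (by positivity)
  have hW₂ : ∑ r' ∈ E₂, prodWeight (admWeight A) r' ≤ K * eCol p (2 * K + 1) lam := by
    have h := weight_exists_manyBlocked_le hw hw1 hp0 hwp' T' s₀ (by positivity : (0 : ℝ) <
      2 * K + 1) hlam
    unfold eCol
    exact h.trans (mul_le_mul_of_nonneg_right hT'K (exp_pos _).le)
  have hW₃ : ∑ r' ∈ E₃, prodWeight (admWeight A) r' ≤ (T.card : ℝ) * m * eRow p (2 * K + 1) t₂ :=
    weight_exists_rowKillOn_le S hw hw1 hp0 hwp' T T'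
      (fun c i => (sum_row_card_coCurves_le T' c i (S c i)).trans (hinc c)) hpI ht₂
  have hW₄ : ∑ r' ∈ E₄, prodWeight (admWeight A) r' ≤ (T.card : ℝ) * m * eCol p (2 * K + 1) t₂ :=
    weight_exists_colKillOn_le R hw hw1 hp0 hwp' T T'
      (fun c j => (sum_col_card_coCurves_le T' c j (R c j)).trans (hinc c)) hpI ht₂
  have hW₅ : ∑ r' ∈ E₅, prodWeight (admWeight A) r' ≤ (T.card : ℝ) * m * eRow p (2 * K + 1) δ :=
    weight_exists_rowKillOn_le (fun _ _ => Finset.univ) hw hw1 hp0 hwp' T T'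
      (fun c i => (sum_row_card_coCurves_le T' c i Finset.univ).trans (hinc c)) hpI hδ
  have hW₆ : ∑ r' ∈ E₆, prodWeight (admWeight A) r' ≤ (T.card : ℝ) * m * eCol p (2 * K + 1) δ :=
    weight_exists_colKillOn_le (fun _ _ => Finset.univ) hw hw1 hp0 hwp' T T'
      (fun c j => (sum_col_card_coCurves_le T' c j Finset.univ).trans (hinc c)) hpI hδ
  have hnn := prodWeight_nonneg hw
  have hU : ∑ r' ∈ E₁ ∪ E₂ ∪ E₃ ∪ E₄ ∪ E₅ ∪ E₆, prodWeight (admWeight A) r' < 1 := by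
    have u5 := weight_union_le (E₁ ∪ E₂ ∪ E₃ ∪ E₄ ∪ E₅) E₆ hnn
    have u4 := weight_union_le (E₁ ∪ E₂ ∪ E₃ ∪ E₄) E₅ hnn
    have u3 := weight_union_le (E₁ ∪ E₂ ∪ E₃) E₄ hnn
    have u2 := weight_union_le (E₁ ∪ E₂) E₃ hnn
    have u1 := weight_union_le E₁ E₂ hnn
    linarith
  obtain ⟨r', hr', hadm⟩ := exists_adm_not_mem A hA _ hU
  simp only [Finset.mem_union, not_or] at hr'
  obtain ⟨⟨⟨⟨⟨h1, h2⟩, h3⟩, h4⟩, h5⟩, h6⟩ := hr'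
  refine ⟨r', fun c hc => ?_, ?_, fun c hc => ?_, fun c hc i => ?_, fun c hc j => ?_,
    fun c hc i => ?_, fun c hc j => ?_⟩
  · have := hadm c
    rw [hAdef] at this
    simpa only [if_pos hc] using this
  · by_contra hge
    exact h1 (Finset.mem_filter.mpr ⟨Finset.mem_univ _, not_lt.mp hge⟩)
  · by_contra hge
    refine h2 (Finset.mem_filter.mpr ⟨Finset.mem_univ _, c, hc, ?_, not_lt.mp hge⟩)
    exact (colLoad_le T' c s₀).trans (hinc c)
  · by_contra hge
    exact h3 (Finset.mem_filter.mpr ⟨Finset.mem_univ _, c, hc, i, not_lt.mp hge⟩)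
  · by_contra hge
    exact h4 (Finset.mem_filter.mpr ⟨Finset.mem_univ _, c, hc, j, not_lt.mp hge⟩)
  · by_contra hge
    exact h5 (Finset.mem_filter.mpr ⟨Finset.mem_univ _, c, hc, i, not_lt.mp hge⟩)
  · by_contra hge
    exact h6 (Finset.mem_filter.mpr ⟨Finset.mem_univ _, c, hc, j, not_lt.mp hge⟩)

end Summit.ValiantsHypothesis.ValiantsHypothesis.Theorems.DefinabilityGapRepick
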